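import Mathlib
import HarnessLib
import Summits.NavierStokesRegularity.NavierStokesRegularity.Theorems.PoloidalWindowDoorLrcModEntireGraphSheetUniqueness
import Summits.NavierStokesRegularity.NavierStokesRegularity.Theorems.PoloidalWindowDoorLrcModEntireHorizontalGerm
import Summits.NavierStokesRegularity.NavierStokesRegularity.Theorems.PoloidalWindowDoorPoloidalWindowRigidityTimeHeightShearLinearSlice

/-!
# Route `PoloidalWindowDoor`, item `LrcModEntire` (stmt-NavierStokesRegularity-20428), cell (Q4-curved), VERTICAL child `stub_Q4curvedAperiodicVertical` —
# A FLAT CRITICAL CURTAIN MAKES THE SLICE `s`-FREE (analytic Cauchy uniqueness across a non-characteristic vertical PLANE; first arrow of VERT-PROP-g18 v2 §8(A))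

Cell ns-regularity-ideate, stub-worker seat ns-poloidal-K2-p2 g18 under the LEAD of item 20428 (ns-poloidal-K2-p3 g18); `--supports stmt-NavierStokesRegularity-20428
--as helper`.  Memo `Cruxes/LrcModEntire/VERT-PROP-g18.md` v2 §8(A): «a FLAT curtain gives Cauchy data on a non-characteristic PLANE that are (s-free, 0) for U₂: by
CK/Holmgren for the slice law μΔₕU₂ + ∂_z²U₂ = 0, U₂ is s-FREE».  This file proves that arrow, class-free, as a COROLLARY of this seat's
`…GraphSheetUniqueness.eqOn_zero_nhds_of_graphSheet` (the graph sheet with CONSTANT graph function `G ≡ c` is the vertical plane `{s·e + c·Je + z·e₂}`, and its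
non-characteristic condition `G_z² + μ(1 + G_s²) ≠ 0` reads `μ ≠ 0`):

Setting: `θ : ℝ³ → ℝ` real-analytic on `ℝ³` with the slice law `∂₂²θ = −μ(x₂)·Δₕθ` on the slab `{x₂ ∈ I}` (`I` open, non-empty, `μ ≠ 0` on `I`); `e` a horizontal unit
vector; the FLAT CURTAIN hypothesis: the horizontal gradient of `θ` vanishes on the plane `{s·e + c·Je + z·e₂ : s ∈ ℝ, z ∈ I}`.
* `fderiv_swap` (Schwarz in nested form), `fderiv_apply_eq_zero_of_eventually_line` (a function vanishing along a line through `x` in direction `v` has `∂_v = 0` at `x`);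
* `sliceLaw_fderiv` — the slice law for `w := ∂_e θ` (differentiate the frozen-coefficient law along the horizontal `e`-line, on which `μ(x₂)` is constant);
* ★ `fderiv_apply_eq_zero_of_flatCurtain` — **`∂_e θ ≡ 0` on all of `ℝ³`** (`w`, `Dw` vanish on the plane; jets vanish by `eqOn_zero_nhds_of_graphSheet`; identity theorem);
* ★ `translate_eq_of_flatCurtain` — hence `θ (x + t·e) = θ x` for all `x, t`: the slice is `s`-FREE;
* ★★ `false_of_flatCurtain` (CLASS LEVEL, `t = −1`) — a (TH) class profile (Type-I decay, continuity, mild, div-free, poloidal, slab slope law `∂₂U_b = m(t,x₂)∂_bU₂` on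
  `|t+1|, |x₂| < ρ`) with a FLAT CRITICAL CURTAIN `∇ₕU₂(−1) = 0` on `{s·e + c·Je + z·e₂ : z ∈ I}` (`I ⊆ (−ρ,ρ)` open non-empty, `m(−1,·) ≠ 0` on `I`) and a non-zero hot value
  `U₂(−1,0) ≠ 0` is CONTRADICTORY: slice law from `plane_wave_identity`, then `fderiv_apply_eq_zero_of_flatCurtain`, then the tree's horizontal-germ endgame
  `…HorizontalGerm.false_of_horizontalDeriv_two_eq_zero` (K2-p3 g16 / port-2 g7).  This is the whole kernel side of §8(A) after the blow-down;
  `false_of_flatCurtain_plane` — the same with the curtain given as the plane `{⟪y − y₀, n⟫ = 0}` (`n` a horizontal unit normal), the LEAD's currency.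

WHAT THIS IS NOT: not a claim about Navier–Stokes regularity; a class-free uniqueness lemma for the research residue `stub_Q4curvedAperiodicVertical` (registry v16);
the blow-down producing a flat curtain (§8(A)) is NOT claimed; items 20428 / 19708 / 27893 OPEN (bears_on LADDER-NS N0).
-/

noncomputable section

set_option linter.dupNamespace false
set_option linter.style.longLine false

namespace Summit.NavierStokesRegularity.NavierStokesRegularity.Theorems.PoloidalWindowDoorLrcModEntireFlatCurtain

open Set Function Filter Topology
open scoped InnerProductSpace RealInnerProductSpace ContDiff
open Summit.NavierStokesRegularity.NavierStokesRegularity.Theorems.PoloidalWindowDoorLrcModEntireSheetFlattenTools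
open Summit.NavierStokesRegularity.NavierStokesRegularity.Theorems.PoloidalWindowDoorLrcModEntireParallelWebsIdentity
open Summit.NavierStokesRegularity.NavierStokesRegularity.Theorems.PoloidalWindowDoorLrcModEntireRidgeGlobalBranchFrame
open Summit.NavierStokesRegularity.NavierStokesRegularity.Theorems.PoloidalWindowDoorLrcModEntireGraphSheetUniqueness
open Summit.NavierStokesRegularity.NavierStokesRegularity.Theorems.PoloidalWindowDoorLrcModEntireHorizontalGerm
open Summit.NavierStokesRegularity.NavierStokesRegularity.Theorems.PoloidalWindowDoorPoloidalWindowRigidityTimeHeightShearLinearSlice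
open Summit.NavierStokesRegularity.NavierStokesRegularity.Theorems.PoloidalWindowDoorPoloidalWindowRigidityConstantShearSlice
open Summit.NavierStokesRegularity.NavierStokesRegularity.Theorems.LocalSineTubeDoorProfileAlignedWindowRigidityAncient

variable {θ : EuclideanSpace ℝ (Fin 3) → ℝ}

/-! ### A. Nested-derivative calculus -/

/-- `y ↦ ∂_u θ(y)` is `C^∞` for `θ ∈ C^∞`. -/
theorem contDiff_fderiv_apply (hθ : ContDiff ℝ ∞ θ) (u : EuclideanSpace ℝ (Fin 3)) : ContDiff ℝ ∞ (fun y => fderiv ℝ θ y u) :=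
  (hθ.fderiv_right (m := ∞) (by simp)).clm_apply contDiff_const

/-- **Schwarz, nested form**: `∂_a(∂_b θ) = ∂_b(∂_a θ)` for `θ ∈ C^∞`. -/
theorem fderiv_swap (hθ : ContDiff ℝ ∞ θ) (x a b : EuclideanSpace ℝ (Fin 3)) :
    fderiv ℝ (fun y => fderiv ℝ θ y b) x a = fderiv ℝ (fun y => fderiv ℝ θ y a) x b := by
  have h2 : ContDiff ℝ 2 θ := hθ.of_le (by norm_cast)
  rw [nested_eq_fderiv_fderiv h2, nested_eq_fderiv_fderiv h2]
  exact (h2.contDiffAt.isSymmSndFDerivAt (by simp)) a b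

/-- **Line lemma**: if `f` is differentiable at `x` and vanishes along the line `t ↦ x + t·v` for `t` near `0`, then `∂_v f(x) = 0`. -/
theorem fderiv_apply_eq_zero_of_eventually_line {f : EuclideanSpace ℝ (Fin 3) → ℝ} {x v : EuclideanSpace ℝ (Fin 3)} (hf : DifferentiableAt ℝ f x)
    (h0 : ∀ᶠ t : ℝ in 𝓝 0, f (x + t • v) = 0) : fderiv ℝ f x v = 0 := by
  have hl : HasDerivAt (fun t : ℝ => x + t • v) v 0 := by
    have h := ((hasDerivAt_id (0 : ℝ)).smul_const v).const_add x
    simpa using h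
  have hx : x + (0 : ℝ) • v = x := by simp
  have hc : HasDerivAt (fun t : ℝ => f (x + t • v)) (fderiv ℝ f x v) 0 := by
    have hf' : HasFDerivAt f (fderiv ℝ f x) (x + (0 : ℝ) • v) := by rw [hx]; exact hf.hasFDerivAt
    exact hf'.comp_hasDerivAt 0 hl
  have hz : HasDerivAt (fun t : ℝ => f (x + t • v)) 0 0 := by
    have h := (hasDerivAt_const (0 : ℝ) (0 : ℝ)).congr_of_eventuallyEq (h0.mono fun t ht => ht)
    exact h
  exact hc.unique hz

/-! ### B. The slice law for `∂_e θ` -/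

section law

variable {I : Set ℝ} {μ : ℝ → ℝ} {e : EuclideanSpace ℝ (Fin 3)}

/-- **The slice law differentiated along a horizontal direction.**  If `∂₂²θ = −μ(x₂)Δₕθ` on the slab `{x₂ ∈ I}` and `e` is horizontal, then `w := ∂_e θ` satisfies
the same law on the slab (along the `e`-line through `x` the coefficient `μ(x₂)` is constant, so no regularity of `μ` is needed). -/
theorem sliceLaw_fderiv (hθ : ContDiff ℝ ∞ θ) (he2 : e 2 = 0)
    (hlaw : ∀ x : EuclideanSpace ℝ (Fin 3), x 2 ∈ I →
      fderiv ℝ (fun y => fderiv ℝ θ y (EuclideanSpace.single 2 (1 : ℝ))) x (EuclideanSpace.single 2 (1 : ℝ)) =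
        -μ (x 2) * (fderiv ℝ (fun y => fderiv ℝ θ y (EuclideanSpace.single 0 (1 : ℝ))) x (EuclideanSpace.single 0 (1 : ℝ)) +
          fderiv ℝ (fun y => fderiv ℝ θ y (EuclideanSpace.single 1 (1 : ℝ))) x (EuclideanSpace.single 1 (1 : ℝ))))
    (x : EuclideanSpace ℝ (Fin 3)) (hx : x 2 ∈ I) :
    fderiv ℝ (fun y => fderiv ℝ (fun y' => fderiv ℝ θ y' e) y (EuclideanSpace.single 2 (1 : ℝ))) x (EuclideanSpace.single 2 (1 : ℝ)) =
      -μ (x 2) * (fderiv ℝ (fun y => fderiv ℝ (fun y' => fderiv ℝ θ y' e) y (EuclideanSpace.single 0 (1 : ℝ))) x (EuclideanSpace.single 0 (1 : ℝ)) +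
        fderiv ℝ (fun y => fderiv ℝ (fun y' => fderiv ℝ θ y' e) y (EuclideanSpace.single 1 (1 : ℝ))) x (EuclideanSpace.single 1 (1 : ℝ))) := by
  -- Schwarz inside: `∂_u ∂_e θ = ∂_e ∂_u θ` as functions, then Schwarz outside on `∂_u θ`
  have hin : ∀ u : EuclideanSpace ℝ (Fin 3), (fun y => fderiv ℝ (fun y' => fderiv ℝ θ y' e) y u) = fun y => fderiv ℝ (fun y' => fderiv ℝ θ y' u) y e :=
    fun u => funext fun y => fderiv_swap hθ y u e
  have hout : ∀ u : EuclideanSpace ℝ (Fin 3),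
      fderiv ℝ (fun y => fderiv ℝ (fun y' => fderiv ℝ θ y' u) y e) x u = fderiv ℝ (fun y => fderiv ℝ (fun y' => fderiv ℝ θ y' u) y u) x e :=
    fun u => fderiv_swap (contDiff_fderiv_apply hθ u) x u e
  simp only [hin, hout]
  -- the frozen-coefficient law vanishes along the `e`-line through `x`
  set e₀ : EuclideanSpace ℝ (Fin 3) := EuclideanSpace.single 0 (1 : ℝ) with he₀
  set e₁ : EuclideanSpace ℝ (Fin 3) := EuclideanSpace.single 1 (1 : ℝ) with he₁
  set e₃ : EuclideanSpace ℝ (Fin 3) := EuclideanSpace.single 2 (1 : ℝ) with he₃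
  set A : EuclideanSpace ℝ (Fin 3) → ℝ := fun y => fderiv ℝ (fun y' => fderiv ℝ θ y' e₃) y e₃ with hA
  set B₀ : EuclideanSpace ℝ (Fin 3) → ℝ := fun y => fderiv ℝ (fun y' => fderiv ℝ θ y' e₀) y e₀ with hB₀
  set B₁ : EuclideanSpace ℝ (Fin 3) → ℝ := fun y => fderiv ℝ (fun y' => fderiv ℝ θ y' e₁) y e₁ with hB₁
  have hAd : Differentiable ℝ A := ((contDiff_fderiv_apply (contDiff_fderiv_apply hθ e₃) e₃).differentiable (by simp))
  have hB₀d : Differentiable ℝ B₀ := ((contDiff_fderiv_apply (contDiff_fderiv_apply hθ e₀) e₀).differentiable (by simp))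
  have hB₁d : Differentiable ℝ B₁ := ((contDiff_fderiv_apply (contDiff_fderiv_apply hθ e₁) e₁).differentiable (by simp))
  set Λ : EuclideanSpace ℝ (Fin 3) → ℝ := fun y => A y + μ (x 2) * (B₀ y + B₁ y) with hΛ
  have hΛ0 : ∀ t : ℝ, Λ (x + t • e) = 0 := by
    intro t
    have h2 : (x + t • e) 2 = x 2 := by simp [he2]
    have h := hlaw (x + t • e) (by rw [h2]; exact hx)
    rw [h2] at h
    show A (x + t • e) + μ (x 2) * (B₀ (x + t • e) + B₁ (x + t • e)) = 0
    simp only [hA, hB₀, hB₁]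
    linarith [h]
  have hΛd : DifferentiableAt ℝ Λ x := ((hAd x).add (((hB₀d x).add (hB₁d x)).const_mul _))
  have hΛe : fderiv ℝ Λ x e = 0 := fderiv_apply_eq_zero_of_eventually_line hΛd (Filter.Eventually.of_forall hΛ0)
  have hexp : fderiv ℝ Λ x e = fderiv ℝ A x e + μ (x 2) * (fderiv ℝ B₀ x e + fderiv ℝ B₁ x e) := by
    have h1 : HasFDerivAt Λ (fderiv ℝ A x + μ (x 2) • (fderiv ℝ B₀ x + fderiv ℝ B₁ x)) x :=
      (hAd x).hasFDerivAt.add (((hB₀d x).hasFDerivAt.add (hB₁d x).hasFDerivAt).const_mul (μ (x 2)))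
    rw [h1.fderiv]
    simp [smul_eq_mul, mul_add]
  rw [hexp] at hΛe
  linarith

end law

/-! ### C. The flat curtain -/

section curtain

variable {I : Set ℝ} {μ : ℝ → ℝ} {e : EuclideanSpace ℝ (Fin 3)} {c : ℝ}

/-- The flat sheet `p ↦ p.1·e + c·Je + p.2·e₂` moves along `e` when `p.1` does. -/
theorem webMap_const_add_fst (e : EuclideanSpace ℝ (Fin 3)) (c : ℝ) (p : ℝ × ℝ) (t : ℝ) :
    webMap e (fun _ => c) p + t • e = webMap e (fun _ => c) (p.1 + t, p.2) := by
  simp only [webMap, add_smul]; abel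

/-- … and along `e₂` when `p.2` does. -/
theorem webMap_const_add_snd (e : EuclideanSpace ℝ (Fin 3)) (c : ℝ) (p : ℝ × ℝ) (t : ℝ) :
    webMap e (fun _ => c) p + t • e2 = webMap e (fun _ => c) (p.1, p.2 + t) := by
  simp only [webMap, add_smul]; abel

/-- ★ **A FLAT CRITICAL CURTAIN MAKES `∂_e θ ≡ 0` ON ALL OF `ℝ³`.**  See the module docstring. -/
theorem fderiv_apply_eq_zero_of_flatCurtain (hθ : AnalyticOnNhd ℝ θ univ) (hI : IsOpen I) (hne : I.Nonempty) (hμ : ∀ z ∈ I, μ z ≠ 0)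
    (he2 : e 2 = 0) (hun : ‖e‖ = 1) (c : ℝ)
    (hlaw : ∀ x : EuclideanSpace ℝ (Fin 3), x 2 ∈ I →
      fderiv ℝ (fun y => fderiv ℝ θ y (EuclideanSpace.single 2 (1 : ℝ))) x (EuclideanSpace.single 2 (1 : ℝ)) =
        -μ (x 2) * (fderiv ℝ (fun y => fderiv ℝ θ y (EuclideanSpace.single 0 (1 : ℝ))) x (EuclideanSpace.single 0 (1 : ℝ)) +
          fderiv ℝ (fun y => fderiv ℝ θ y (EuclideanSpace.single 1 (1 : ℝ))) x (EuclideanSpace.single 1 (1 : ℝ))))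
    (hcurt : ∀ p ∈ region I, ∀ v : EuclideanSpace ℝ (Fin 3), v 2 = 0 → fderiv ℝ θ (webMap e (fun _ => c) p) v = 0) :
    ∀ x : EuclideanSpace ℝ (Fin 3), fderiv ℝ θ x e = 0 := by
  have hθC : ContDiff ℝ ∞ θ := contDiffOn_univ.1 hθ.contDiffOn_of_completeSpace
  have hθd : Differentiable ℝ θ := hθC.differentiable (by simp)
  set w : EuclideanSpace ℝ (Fin 3) → ℝ := fun y => fderiv ℝ θ y e with hw_def
  -- `w` is real-analytic on `ℝ³`
  have hw : AnalyticOnNhd ℝ w univ := fun y _ =>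
    ((ContinuousLinearMap.apply ℝ ℝ e).analyticAt _).comp (hθ.fderiv y (mem_univ _))
  have hwC : ContDiff ℝ ∞ w := contDiff_fderiv_apply hθC e
  have hwd : Differentiable ℝ w := hwC.differentiable (by simp)
  have hJ2 : rotJ e 2 = 0 := (rotJ_facts he2 hun).1
  have hJv : Jvec e = rotJ e := rfl
  -- zero Cauchy data on the plane
  have h0 : ∀ p ∈ region I, w (webMap e (fun _ => c) p) = 0 := fun p hp => hcurt p hp e he2
  have h1 : ∀ p ∈ region I, fderiv ℝ w (webMap e (fun _ => c) p) = 0 := by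
    intro p hp
    have hp2 : p.2 ∈ I := hp
    -- the three frame directions
    have hE : fderiv ℝ w (webMap e (fun _ => c) p) e = 0 := by
      refine fderiv_apply_eq_zero_of_eventually_line (hwd _) (Filter.Eventually.of_forall fun t => ?_)
      rw [webMap_const_add_fst]; exact h0 _ (show (p.1 + t, p.2) ∈ region I from hp2)
    have hZ : fderiv ℝ w (webMap e (fun _ => c) p) e2 = 0 := by
      refine fderiv_apply_eq_zero_of_eventually_line (hwd _) ?_
      have hev : ∀ᶠ t : ℝ in 𝓝 0, p.2 + t ∈ I := by
        have hc : Continuous fun t : ℝ => p.2 + t := continuous_const.add continuous_id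
        exact hc.continuousAt.preimage_mem_nhds (hI.mem_nhds (by simpa using hp2))
      filter_upwards [hev] with t ht
      rw [webMap_const_add_snd]; exact h0 _ (show (p.1, p.2 + t) ∈ region I from ht)
    have hN : fderiv ℝ w (webMap e (fun _ => c) p) (rotJ e) = 0 := by
      rw [hw_def, fderiv_swap hθC]
      refine fderiv_apply_eq_zero_of_eventually_line (((contDiff_fderiv_apply hθC (rotJ e)).differentiable (by simp)) _)
        (Filter.Eventually.of_forall fun t => ?_)
      rw [webMap_const_add_fst]; exact hcurt _ (show (p.1 + t, p.2) ∈ region I from hp2) (rotJ e) hJ2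
    ext u
    have hdec := decomp_graphFrame he2 hun 0 0 u
    simp only [zero_smul, add_zero, zero_add, zero_mul, sub_zero] at hdec
    rw [hdec]
    simp [hE, hZ, hN]
  -- the plane is non-characteristic: `μ ≠ 0`
  have hG : ∀ p ∈ region I, DifferentiableAt ℝ (fun _ : ℝ × ℝ => c) p := fun _ _ => differentiableAt_const c
  have hQ : ∀ p ∈ region I, (fderiv ℝ (fun _ : ℝ × ℝ => c) p (0, 1)) ^ 2 + μ p.2 * (1 + (fderiv ℝ (fun _ : ℝ × ℝ => c) p (1, 0)) ^ 2) ≠ 0 := by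
    intro p hp
    rw [(hasFDerivAt_const c p).fderiv]
    simpa using hμ p.2 hp
  -- the slice law for `w`
  have hlaw_w := sliceLaw_fderiv (I := I) (μ := μ) hθC he2 hlaw
  -- all jets vanish ⇒ `w = 0` near a plane point ⇒ everywhere
  obtain ⟨z₀, hz₀⟩ := hne
  have hp₀ : ((0 : ℝ), z₀) ∈ region I := hz₀
  have hev := eqOn_zero_nhds_of_graphSheet hw hI hG he2 hun (fun x hx => hlaw_w x hx) h0 h1 hQ hp₀
  have hzero := hw.eqOn_zero_of_preconnected_of_eventuallyEq_zero isPreconnected_univ (mem_univ _) hev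
  intro x
  exact hzero (mem_univ x)

/-- ★ **… HENCE THE SLICE IS `s`-FREE**: `θ (x + t·e) = θ x` for all `x`, `t`. -/
theorem translate_eq_of_flatCurtain (hθ : AnalyticOnNhd ℝ θ univ) (hI : IsOpen I) (hne : I.Nonempty) (hμ : ∀ z ∈ I, μ z ≠ 0)
    (he2 : e 2 = 0) (hun : ‖e‖ = 1) (c : ℝ)
    (hlaw : ∀ x : EuclideanSpace ℝ (Fin 3), x 2 ∈ I →
      fderiv ℝ (fun y => fderiv ℝ θ y (EuclideanSpace.single 2 (1 : ℝ))) x (EuclideanSpace.single 2 (1 : ℝ)) =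
        -μ (x 2) * (fderiv ℝ (fun y => fderiv ℝ θ y (EuclideanSpace.single 0 (1 : ℝ))) x (EuclideanSpace.single 0 (1 : ℝ)) +
          fderiv ℝ (fun y => fderiv ℝ θ y (EuclideanSpace.single 1 (1 : ℝ))) x (EuclideanSpace.single 1 (1 : ℝ))))
    (hcurt : ∀ p ∈ region I, ∀ v : EuclideanSpace ℝ (Fin 3), v 2 = 0 → fderiv ℝ θ (webMap e (fun _ => c) p) v = 0)
    (x : EuclideanSpace ℝ (Fin 3)) (t : ℝ) : θ (x + t • e) = θ x := by
  have hθC : ContDiff ℝ ∞ θ := contDiffOn_univ.1 hθ.contDiffOn_of_completeSpace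
  have hθd : Differentiable ℝ θ := hθC.differentiable (by simp)
  have hz := fderiv_apply_eq_zero_of_flatCurtain hθ hI hne hμ he2 hun c hlaw hcurt
  -- the line function has zero derivative
  have hderiv : ∀ s : ℝ, HasDerivAt (fun s : ℝ => θ (x + s • e)) 0 s := by
    intro s
    have hl : HasDerivAt (fun s : ℝ => x + s • e) e s := by
      have h := ((hasDerivAt_id s).smul_const e).const_add x
      simpa using h
    have h := (hθd (x + s • e)).hasFDerivAt.comp_hasDerivAt s hl
    rw [hz] at h
    exact h
  have hconst := is_const_of_deriv_eq_zero (fun s => (hderiv s).differentiableAt) (fun s => (hderiv s).deriv) t 0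
  simpa using hconst

end curtain


/-! ### D. Class level: a flat critical curtain at the hot time is contradictory -/

section endgame

open Literature.Analysis Literature.Analysis.FluidPDE Literature.Analysis.UnboundedOperators

/-- ★★ **A FLAT CRITICAL CURTAIN AT `t = −1` IS CONTRADICTORY FOR A (TH) CLASS PROFILE WITH A NON-ZERO HOT VALUE.**  See the module docstring. -/
theorem false_of_flatCurtain {C : ℝ} {U : ℝ → EuclideanSpace ℝ (Fin 3) → EuclideanSpace ℝ (Fin 3)}
    (hrate : HasTypeITimeDecay C U) (hcont : ContinuousOn (uncurry U) (Iio (0 : ℝ) ×ˢ univ))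
    (hmild : ∀ s t : ℝ, s < t → t < 0 → ∀ x, U t x = heatExtension (U s) (t - s) x - oseenDuhamel 1 s U U t x)
    (hdiv : ∀ t < 0, VectorCalculus.IsDivFree (U t))
    (hpol : ∀ s < 0, ∀ y, ⟪curl (U s) y, EuclideanSpace.single 2 1⟫_ℝ = 0)
    {m : ℝ → ℝ → ℝ} {ρ : ℝ} (hρ : 0 < ρ)
    (hslabU : ∀ t : ℝ, |t + 1| < ρ → ∀ x : EuclideanSpace ℝ (Fin 3), |x 2| < ρ → ∀ b : Fin 3, b ≠ 2 →
      fderiv ℝ (U t) x (EuclideanSpace.single 2 1) b = m t (x 2) * fderiv ℝ (U t) x (EuclideanSpace.single b 1) 2)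
    {I : Set ℝ} (hI : IsOpen I) (hne : I.Nonempty) (hIρ : ∀ z ∈ I, |z| < ρ) (hμ : ∀ z ∈ I, m (-1) z ≠ 0)
    {e : EuclideanSpace ℝ (Fin 3)} (he2 : e 2 = 0) (hun : ‖e‖ = 1) (c : ℝ)
    (hcurt : ∀ p ∈ region I, ∀ v : EuclideanSpace ℝ (Fin 3), v 2 = 0 → fderiv ℝ (fun y => U (-1) y 2) (webMap e (fun _ => c) p) v = 0)
    (hN : U (-1) 0 2 ≠ 0) : False := by
  have hs : (-1 : ℝ) < 0 := by norm_num
  have hUan : AnalyticOnNhd ℝ (U (-1)) univ := analyticOnNhd_slice hcont (bdd_of_hasTypeITimeDecay hrate) hmild hs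
  have hU2 : ContDiff ℝ 2 (U (-1)) := hUan.contDiff
  have hθan : AnalyticOnNhd ℝ (fun y => U (-1) y 2) univ := fun y _ =>
    ((EuclideanSpace.proj (2 : Fin 3) : EuclideanSpace ℝ (Fin 3) →L[ℝ] ℝ).analyticAt _).comp (hUan y (mem_univ _))
  -- the slope law on the planes `x₂ = z`, `|z| < ρ`, and the slice law on the slab `{x₂ ∈ I}`
  have hplane : ∀ z : ℝ, |z| < ρ → ∀ y : EuclideanSpace ℝ (Fin 3), y 2 = z → ∀ b : Fin 3, b ≠ 2 →
      fderiv ℝ (U (-1)) y (EuclideanSpace.single 2 (1 : ℝ)) b = m (-1) z * fderiv ℝ (U (-1)) y (EuclideanSpace.single b (1 : ℝ)) 2 := by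
    intro z hz y hy b hb
    have h := hslabU (-1) (by simpa using hρ) y (by rw [hy]; exact hz) b hb
    rw [hy] at h; exact h
  have hlaw : ∀ x : EuclideanSpace ℝ (Fin 3), x 2 ∈ I →
      fderiv ℝ (fun y => fderiv ℝ (fun y' => U (-1) y' 2) y (EuclideanSpace.single 2 (1 : ℝ))) x (EuclideanSpace.single 2 (1 : ℝ)) =
        -m (-1) (x 2) * (fderiv ℝ (fun y => fderiv ℝ (fun y' => U (-1) y' 2) y (EuclideanSpace.single 0 (1 : ℝ))) x (EuclideanSpace.single 0 (1 : ℝ)) +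
          fderiv ℝ (fun y => fderiv ℝ (fun y' => U (-1) y' 2) y (EuclideanSpace.single 1 (1 : ℝ))) x (EuclideanSpace.single 1 (1 : ℝ))) :=
    fun x hx => plane_wave_identity hU2 (fun y => div_coord (hdiv _ hs) y) (hplane (x 2) (hIρ _ hx)) rfl
  -- the curtain kills `∂_e U₂(−1,·)` everywhere; the horizontal-germ endgame kills `U`
  have hz := fderiv_apply_eq_zero_of_flatCurtain (μ := m (-1)) hθan hI hne hμ he2 hun c hlaw hcurt
  have he : e ≠ 0 := by
    intro h; rw [h, norm_zero] at hun; exact zero_ne_one hun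
  exact false_of_horizontalDeriv_two_eq_zero hrate hcont hmild hdiv hpol hρ
    (fun x hx b hb => hslabU (-1) (by simpa using hρ) x hx b hb) he he2 (fun x _ => hz x) hN

/-- ★★ **Plane form** (the LEAD's currency, VERT-PROP v2 §8(A)): the flat curtain given as the vertical PLANE `{y : ⟪y − y₀, n⟫ = 0}` with horizontal unit normal `n`, on
the layer `|y₂| < ρ′ ≤ ρ` where `m(−1,·) ≠ 0`; horizontal criticality of `U₂(−1,·)` on it + the class + the slab law + a non-zero hot value ⊢ `False`. -/
theorem false_of_flatCurtain_plane {C : ℝ} {U : ℝ → EuclideanSpace ℝ (Fin 3) → EuclideanSpace ℝ (Fin 3)}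
    (hrate : HasTypeITimeDecay C U) (hcont : ContinuousOn (uncurry U) (Iio (0 : ℝ) ×ˢ univ))
    (hmild : ∀ s t : ℝ, s < t → t < 0 → ∀ x, U t x = heatExtension (U s) (t - s) x - oseenDuhamel 1 s U U t x)
    (hdiv : ∀ t < 0, VectorCalculus.IsDivFree (U t))
    (hpol : ∀ s < 0, ∀ y, ⟪curl (U s) y, EuclideanSpace.single 2 1⟫_ℝ = 0)
    {m : ℝ → ℝ → ℝ} {ρ : ℝ} (hρ : 0 < ρ)
    (hslabU : ∀ t : ℝ, |t + 1| < ρ → ∀ x : EuclideanSpace ℝ (Fin 3), |x 2| < ρ → ∀ b : Fin 3, b ≠ 2 →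
      fderiv ℝ (U t) x (EuclideanSpace.single 2 1) b = m t (x 2) * fderiv ℝ (U t) x (EuclideanSpace.single b 1) 2)
    {n y₀ : EuclideanSpace ℝ (Fin 3)} (hn2 : n 2 = 0) (hnu : ‖n‖ = 1) {ρ' : ℝ} (hρ' : 0 < ρ') (hρ'ρ : ρ' ≤ ρ)
    (hμ : ∀ z : ℝ, |z| < ρ' → m (-1) z ≠ 0)
    (hcurt : ∀ y : EuclideanSpace ℝ (Fin 3), ⟪y - y₀, n⟫ = 0 → |y 2| < ρ' → ∀ w : EuclideanSpace ℝ (Fin 3), w 2 = 0 →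
      fderiv ℝ (fun y' => U (-1) y' 2) y w = 0)
    (hN : U (-1) 0 2 ≠ 0) : False := by
  -- the in-plane horizontal direction `e := Jn`; then `Je = −n`
  set e : EuclideanSpace ℝ (Fin 3) := rotJ n with he_def
  have he2 : e 2 = 0 := (rotJ_facts hn2 hnu).1
  have hun : ‖e‖ = 1 := (rotJ_facts hn2 hnu).2.1
  have hJe : Jvec e = -n := by
    have h : Jvec e = rotJ (rotJ n) := rfl
    rw [h]; ext i; fin_cases i <;> simp [rotJ, hn2]
  set c : ℝ := -⟪y₀, n⟫ with hc_def
  have hcurt' : ∀ p ∈ region (Ioo (-ρ') ρ'), ∀ v : EuclideanSpace ℝ (Fin 3), v 2 = 0 →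
      fderiv ℝ (fun y' => U (-1) y' 2) (webMap e (fun _ => c) p) v = 0 := by
    intro p hp v hv
    have hp' : p.2 ∈ Ioo (-ρ') ρ' := hp
    have hpt : webMap e (fun _ => c) p = p.1 • e + c • (-n) + p.2 • e2 := by simp only [webMap, hJe]
    refine hcurt _ ?_ ?_ v hv
    · -- `⟪y − y₀, n⟫ = 0`
      have hen : ⟪e, n⟫ = 0 := (rotJ_facts hn2 hnu).2.2.2
      have hnn : ⟪n, n⟫ = 1 := by rw [real_inner_self_eq_norm_sq, hnu]; norm_num
      have h2n : ⟪e2, n⟫ = 0 := by simp [inner_eq_sum3, e2, hn2]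
      rw [hpt, inner_sub_left, inner_add_left, inner_add_left, real_inner_smul_left, real_inner_smul_left, real_inner_smul_left, inner_neg_left,
        hen, hnn, h2n, hc_def]
      ring
    · -- `|y 2| < ρ′`
      have h2 : (webMap e (fun _ => c) p) 2 = p.2 := by
        rw [hpt]; simp [he2, hn2, e2]
      rw [h2]; exact abs_lt.2 ⟨hp'.1, hp'.2⟩
  exact false_of_flatCurtain hrate hcont hmild hdiv hpol hρ hslabU isOpen_Ioo (nonempty_Ioo.2 (by linarith)) (fun z hz => abs_lt.2 ⟨by linarith [hz.1], by linarith [hz.2]⟩)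
    (fun z hz => hμ z (abs_lt.2 ⟨hz.1, hz.2⟩)) he2 hun c hcurt' hN

end endgame

end Summit.NavierStokesRegularity.NavierStokesRegularity.Theorems.PoloidalWindowDoorLrcModEntireFlatCurtain

end
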